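import Mathlib
import Summits.Ventures.PercRepro2.CutSideMasses
import Summits.Ventures.PercRepro2.ClusterThreePoint
import Summits.Ventures.PercRepro2.ClusterThreeMark
import Summits.Ventures.PercRepro2.ClusterOutsideMark

/-!
# Row (LEAF-½) across a cut vertex separating `{a₁, b}` from `{a₂, o, v}` — the cut-vertex class
theorem (blind cell PercRepro2, p5 g27; `proofs/P5-OEDGE.md` §35 addendum 1, the case `t = 1`)

Let `z` be a cut vertex (`CutV.IsCut ends z VA VB EA EB`) with `a₁, b ∈ VA` and `a₂, o, v ∈ VB`.
Every event of the row is read on the two sides: with `Q = {a₁ ↮ a₂} = (A ∩ C)ᶜ`,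
`A = {a₁ ↔ z in A}`, `C = {a₂ ↔ z in B}`, one has `bL = {a₁ ↔ b in A}`, `bH = {b ↔ z in A} ∩ C`,
`oL = A ∩ {o ↔ z in B}`, `oH = {a₂ ↔ o in B}` (and likewise for `v`), and the product law
`prob_sideEvent_inter_eq_mul` turns every `Q`-mass into `P_A(S)·P_B(U) − P_A(S ∩ A)·P_B(U ∩ C)`
(`prob_Qc_inter`).  In these side masses the two halves of the «G2» grouping factorise EXACTLY:

  `groupL = κ · ((1 − α)·T + α·(T − W))`,   `κ = Cov_A(1{a₁↔b}, 1{a₁↔z}) ≥ 0`,  `α = P_A(a₁ ↔ z)`,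
  `groupH = P_A(b ↔ z, a₁ ↮ z) · P_B(a₂ ↔ z) · α · ((1 − α)·hb0 + α·hb1)`,

where `T = T′(a₂; o, v, z) + P_B(v ∈ C, o ↔ z, z ∉ C)`, `T − W = tri(a₂; o, v, z) + (nonnegative masses)`
and `hb0, hb1` are the two ends of the mirror bracket — the one-cluster inequalities
`ClusterThreePoint.T'_nonneg`, `ClusterThreeMark.tri_nonneg`, `ClusterOutsideMark.hb0_nonneg /
hb1_nonneg` applied to the `B`-side weights `p[off EB ↦ 0]` (`prob_zeroOff_eq_prob_sideEvent`).
Hence `0 ≤ groupL`, `0 ≤ groupH` and, by `LeafHalfCrossRed.LeafRow_of_G2`, **row (LEAF-½) holds on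
the class** (`LeafRow_of_cut`).  Nothing here is claimed off the class.
-/

namespace Summit.Ventures.PercRepro2

open UnionCluster CovForm PendantRoot LeafStep LeafHalfCross

namespace CutLeafRow

variable {V : Type*} {E : Type*} [Fintype E] [DecidableEq E] [Fintype V] [DecidableEq V]
  {R : Type*} [Field R] [LinearOrder R] [IsStrictOrderedRing R]

/-! ## The `b`-half: `groupL = κ · (T − α·W)` -/

section HalfL

variable (p : E → R) (ends : E → Sym2 V) (EB : Set E) [DecidablePred (· ∈ EB)]

/-- **The `B`-side `T`** of the one-bridge expansion (`P5-OEDGE.md` §35 add. 1):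
`Cov(O, C_z) + P(O)·Cov(V, C_z) − Cov(V ∩ O, C_z) + P(V, o ↔ z, z ∉ C)`, in side masses. -/
noncomputable def sideT (a₂ o v z : V) : R :=
  prob p (CutV.sideEvent EB (connEvent ends a₂ o ∩ connEvent ends a₂ z)) -
    prob p (CutV.sideEvent EB (connEvent ends a₂ v ∩ connEvent ends a₂ o ∩ connEvent ends a₂ z)) +
    (prob p (CutV.sideEvent EB (connEvent ends a₂ v ∩ connEvent ends o z)) -
      prob p (CutV.sideEvent EB (connEvent ends a₂ v ∩ connEvent ends o z ∩ connEvent ends a₂ z))) -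
    prob p (CutV.sideEvent EB (connEvent ends a₂ o)) * prob p (CutV.sideEvent EB (connEvent ends a₂ z)) +
    prob p (CutV.sideEvent EB (connEvent ends a₂ o)) *
      prob p (CutV.sideEvent EB (connEvent ends a₂ v ∩ connEvent ends a₂ z)) +
    prob p (CutV.sideEvent EB (connEvent ends a₂ z)) *
      prob p (CutV.sideEvent EB (connEvent ends a₂ v ∩ connEvent ends a₂ o)) -
    prob p (CutV.sideEvent EB (connEvent ends a₂ o)) * prob p (CutV.sideEvent EB (connEvent ends a₂ z)) *
      prob p (CutV.sideEvent EB (connEvent ends a₂ v))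

/-- **The `B`-side `W`** of the one-bridge expansion, in side masses. -/
noncomputable def sideW (a₂ o v z : V) : R :=
  - prob p (CutV.sideEvent EB (connEvent ends a₂ o)) * prob p (CutV.sideEvent EB (connEvent ends a₂ z)) ^ 2 +
    prob p (CutV.sideEvent EB (connEvent ends a₂ z)) *
      prob p (CutV.sideEvent EB (connEvent ends a₂ o ∩ connEvent ends a₂ z)) -
    prob p (CutV.sideEvent EB (connEvent ends a₂ z)) *
      prob p (CutV.sideEvent EB (connEvent ends a₂ v ∩ connEvent ends a₂ o ∩ connEvent ends a₂ z)) +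
    prob p (CutV.sideEvent EB (connEvent ends a₂ z)) *
      (prob p (CutV.sideEvent EB (connEvent ends a₂ v ∩ connEvent ends o z)) -
        prob p (CutV.sideEvent EB (connEvent ends a₂ v ∩ connEvent ends o z ∩ connEvent ends a₂ z))) +
    prob p (CutV.sideEvent EB (connEvent ends a₂ z)) ^ 2 *
      prob p (CutV.sideEvent EB (connEvent ends a₂ v ∩ connEvent ends a₂ o)) +
    prob p (CutV.sideEvent EB (connEvent ends a₂ o ∩ connEvent ends a₂ z)) *
      prob p (CutV.sideEvent EB (connEvent ends a₂ v ∩ connEvent ends a₂ z)) -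
    prob p (CutV.sideEvent EB (connEvent ends a₂ v ∩ connEvent ends a₂ z)) *
      (prob p (CutV.sideEvent EB (connEvent ends o z)) -
        prob p (CutV.sideEvent EB (connEvent ends o z ∩ connEvent ends a₂ z))) -
    prob p (CutV.sideEvent EB (connEvent ends a₂ z)) * prob p (CutV.sideEvent EB (connEvent ends a₂ v)) *
      prob p (CutV.sideEvent EB (connEvent ends a₂ o ∩ connEvent ends a₂ z)) +
    prob p (CutV.sideEvent EB (connEvent ends a₂ z)) * prob p (CutV.sideEvent EB (connEvent ends a₂ v)) *
      (prob p (CutV.sideEvent EB (connEvent ends o z)) -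
        prob p (CutV.sideEvent EB (connEvent ends o z ∩ connEvent ends a₂ z)))

variable {z : V} {VA VB : Set V} {EA : Set E} [DecidablePred (· ∈ EA)]

omit [Fintype V] [DecidableEq V] [LinearOrder R] [IsStrictOrderedRing R] in
/-- **The `b`-half factorises across the cut**:
`groupL = [P_A(a₁↔b, a₁↔z) − P_A(a₁↔b)·P_A(a₁↔z)] · (sideT − P_A(a₁↔z) · sideW)`. -/
theorem groupL_eq (h : CutV.IsCut ends z VA VB EA EB) {a₁ a₂ b o v : V} (ha₁ : a₁ ∈ VA)
    (hb : b ∈ VA) (ha₂ : a₂ ∈ VB) (ho : o ∈ VB) (hv : v ∈ VB) :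
    groupL p ends o a₁ a₂ v b =
      (prob p (CutV.sideEvent EA (connEvent ends a₁ b ∩ connEvent ends a₁ z)) -
          prob p (CutV.sideEvent EA (connEvent ends a₁ b)) *
            prob p (CutV.sideEvent EA (connEvent ends a₁ z))) *
        (sideT p ends EB a₂ o v z -
          prob p (CutV.sideEvent EA (connEvent ends a₁ z)) * sideW p ends EB a₂ o v z) := by
  unfold groupL anticov threeC mU sideT sideW
  rw [mass_Q p ends h ha₁ ha₂, mass_bL p ends h ha₁ hb ha₂, mass_oH p ends h ha₁ ha₂ ho,
    mass_oHbL p ends h ha₁ hb ha₂ ho, mass_oH p ends h ha₁ ha₂ hv, mass_oHbL p ends h ha₁ hb ha₂ hv,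
    mass_oL p ends h ha₁ ha₂ ho, mass_vHoLbL p ends h ha₁ hb ha₂ ho hv,
    mass_vHoHbL p ends h ha₁ hb ha₂ ho hv, mass_vHoL p ends h ha₁ ha₂ ho hv,
    mass_vHoH p ends h ha₁ ha₂ ho hv]
  ring

end HalfL

/-! ## The one-cluster inequalities on the `B`-side -/

section BSide

variable (p : E → R) (ends : E → Sym2 V) (EB : Set E) [DecidablePred (· ∈ EB)]

omit [Fintype V] [DecidableEq V] [LinearOrder R] [IsStrictOrderedRing R] in
/-- A side probability as a whole-graph probability under the weights with the other side closed. -/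
lemma side_eq (X : Set (Config E)) :
    prob p (CutV.sideEvent EB X) = prob (fun e => if e ∈ EB then p e else 0) X :=
  (CDCutVertex.prob_zeroOff_eq_prob_sideEvent p EB X).symm

omit [Fintype V] [DecidableEq V] [LinearOrder R] [IsStrictOrderedRing R] in
/-- Side masses split along a complement. -/
lemma side_compl (X Y : Set (Config E)) :
    prob p (CutV.sideEvent EB (X ∩ Yᶜ)) =
      prob p (CutV.sideEvent EB X) - prob p (CutV.sideEvent EB (X ∩ Y)) := by
  have h := prob_inter_add_prob_inter_compl p (CutV.sideEvent EB X) (CutV.sideEvent EB Y)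
  rw [sideEvent_inter] at h
  have e : CutV.sideEvent EB X ∩ (CutV.sideEvent EB Y)ᶜ = CutV.sideEvent EB (X ∩ Yᶜ) :=
    Set.ext fun _ => Iff.rfl
  rw [e] at h
  linear_combination h

omit [Fintype V] [DecidableEq V] in
/-- Side masses are monotone. -/
lemma side_mono (hp : IsProbVec p) {X Y : Set (Config E)} (hXY : X ⊆ Y) :
    prob p (CutV.sideEvent EB X) ≤ prob p (CutV.sideEvent EB Y) :=
  prob_mono hp fun _ hω => hXY hω

omit [Fintype V] [DecidableEq V] [LinearOrder R] [IsStrictOrderedRing R] in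
/-- `sideT = T′(a₂; o, v, z) + P_B(a₂ ↔ v, o ↔ z, a₂ ↮ z)`. -/
lemma sideT_eq (a₂ o v z : V) :
    sideT p ends EB a₂ o v z =
      ClusterThreePoint.T' (fun e => if e ∈ EB then p e else 0) ends a₂ o v z +
        (prob p (CutV.sideEvent EB (connEvent ends a₂ v ∩ connEvent ends o z)) -
          prob p (CutV.sideEvent EB (connEvent ends a₂ v ∩ connEvent ends o z ∩
            connEvent ends a₂ z))) := by
  unfold sideT ClusterThreePoint.T'
  simp only [← side_eq]
  have e1 : connEvent ends a₂ o ∩ connEvent ends a₂ v = connEvent ends a₂ v ∩ connEvent ends a₂ o :=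
    Set.inter_comm _ _
  rw [e1]
  ring

/-- **`sideT ≥ 0`** (`ClusterThreePoint.T'_nonneg` on the `B`-side). -/
theorem sideT_nonneg (hp : IsProbVec p) (a₂ o v z : V) : 0 ≤ sideT p ends EB a₂ o v z := by
  rw [sideT_eq]
  have h1 := ClusterThreePoint.T'_nonneg (fun e => if e ∈ EB then p e else 0) ends
    (CDCutVertex.isProbVec_zeroOff hp EB) a₂ o v z
  have h2 := side_mono p EB hp (X := connEvent ends a₂ v ∩ connEvent ends o z ∩ connEvent ends a₂ z)
    (Y := connEvent ends a₂ v ∩ connEvent ends o z) Set.inter_subset_left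
  linarith

omit [Fintype V] [DecidableEq V] [LinearOrder R] [IsStrictOrderedRing R] in
/-- `sideT − sideW = tri(a₂; o, v, z) + (1 − P_B(a₂↔z))·P_B(a₂↔v, o↔z, a₂↮z) + Cov_B(V, C_z)·P_B(o↔z, a₂↮z)`. -/
lemma sideT_sub_sideW_eq (a₂ o v z : V) :
    sideT p ends EB a₂ o v z - sideW p ends EB a₂ o v z =
      ClusterThreeMark.tri (fun e => if e ∈ EB then p e else 0) ends a₂ o v z +
        (1 - prob p (CutV.sideEvent EB (connEvent ends a₂ z))) *
          (prob p (CutV.sideEvent EB (connEvent ends a₂ v ∩ connEvent ends o z)) -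
            prob p (CutV.sideEvent EB (connEvent ends a₂ v ∩ connEvent ends o z ∩
              connEvent ends a₂ z))) +
        (prob p (CutV.sideEvent EB (connEvent ends a₂ v ∩ connEvent ends a₂ z)) -
            prob p (CutV.sideEvent EB (connEvent ends a₂ v)) *
              prob p (CutV.sideEvent EB (connEvent ends a₂ z))) *
          (prob p (CutV.sideEvent EB (connEvent ends o z)) -
            prob p (CutV.sideEvent EB (connEvent ends o z ∩ connEvent ends a₂ z))) := by
  unfold sideT sideW ClusterThreeMark.tri
  simp only [← side_eq]
  rw [side_compl p EB (connEvent ends a₂ o ∩ connEvent ends a₂ z) (connEvent ends a₂ v),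
    side_compl p EB (connEvent ends a₂ o) (connEvent ends a₂ v),
    side_compl p EB (connEvent ends a₂ o) (connEvent ends a₂ z)]
  have e1 : connEvent ends a₂ o ∩ connEvent ends a₂ z ∩ connEvent ends a₂ v =
      connEvent ends a₂ v ∩ connEvent ends a₂ o ∩ connEvent ends a₂ z := by
    rw [Set.inter_comm, ← Set.inter_assoc]
  have e2 : connEvent ends a₂ o ∩ connEvent ends a₂ v = connEvent ends a₂ v ∩ connEvent ends a₂ o :=
    Set.inter_comm _ _
  rw [e1, e2]
  ring

/-- **`sideT − sideW ≥ 0`** (`ClusterThreeMark.tri_nonneg` on the `B`-side plus nonnegative masses). -/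
theorem sideT_sub_sideW_nonneg (hp : IsProbVec p) (a₂ o v z : V) :
    0 ≤ sideT p ends EB a₂ o v z - sideW p ends EB a₂ o v z := by
  rw [sideT_sub_sideW_eq]
  have h1 := ClusterThreeMark.tri_nonneg (fun e => if e ∈ EB then p e else 0) ends
    (CDCutVertex.isProbVec_zeroOff hp EB) a₂ o v z
  have h2 := side_mono p EB hp (X := connEvent ends a₂ v ∩ connEvent ends o z ∩ connEvent ends a₂ z)
    (Y := connEvent ends a₂ v ∩ connEvent ends o z) Set.inter_subset_left
  have h3 := side_mono p EB hp (X := connEvent ends o z ∩ connEvent ends a₂ z)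
    (Y := connEvent ends o z) Set.inter_subset_left
  have h4 : prob p (CutV.sideEvent EB (connEvent ends a₂ v)) *
      prob p (CutV.sideEvent EB (connEvent ends a₂ z)) ≤
      prob p (CutV.sideEvent EB (connEvent ends a₂ v ∩ connEvent ends a₂ z)) := by
    rw [side_eq, side_eq, side_eq]
    exact prob_mul_prob_le_prob_inter (CDCutVertex.isProbVec_zeroOff hp EB)
      (isUpperSet_connEvent ends a₂ v) (isUpperSet_connEvent ends a₂ z)
  have h5 := prob_le_one hp (CutV.sideEvent EB (connEvent ends a₂ z))
  have h6 : 0 ≤ (1 - prob p (CutV.sideEvent EB (connEvent ends a₂ z))) *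
      (prob p (CutV.sideEvent EB (connEvent ends a₂ v ∩ connEvent ends o z)) -
        prob p (CutV.sideEvent EB (connEvent ends a₂ v ∩ connEvent ends o z ∩
          connEvent ends a₂ z))) := mul_nonneg (by linarith) (by linarith)
  have h7 : 0 ≤ (prob p (CutV.sideEvent EB (connEvent ends a₂ v ∩ connEvent ends a₂ z)) -
      prob p (CutV.sideEvent EB (connEvent ends a₂ v)) *
        prob p (CutV.sideEvent EB (connEvent ends a₂ z))) *
      (prob p (CutV.sideEvent EB (connEvent ends o z)) -
        prob p (CutV.sideEvent EB (connEvent ends o z ∩ connEvent ends a₂ z))) :=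
    mul_nonneg (by linarith) (by linarith)
  linarith

end BSide

/-! ## `0 ≤ groupL` on the class -/

section GroupL

variable (p : E → R) (ends : E → Sym2 V) {z : V} {VA VB : Set V} {EA EB : Set E}
  [DecidablePred (· ∈ EA)] [DecidablePred (· ∈ EB)]

/-- **The `b`-half of (G2) holds across the cut**: `0 ≤ groupL`. -/
theorem groupL_nonneg (hp : IsProbVec p) (h : CutV.IsCut ends z VA VB EA EB) {a₁ a₂ b o v : V}
    (ha₁ : a₁ ∈ VA) (hb : b ∈ VA) (ha₂ : a₂ ∈ VB) (ho : o ∈ VB) (hv : v ∈ VB) :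
    0 ≤ groupL p ends o a₁ a₂ v b := by
  rw [groupL_eq p ends EB h ha₁ hb ha₂ ho hv]
  have hκ : 0 ≤ prob p (CutV.sideEvent EA (connEvent ends a₁ b ∩ connEvent ends a₁ z)) -
      prob p (CutV.sideEvent EA (connEvent ends a₁ b)) *
        prob p (CutV.sideEvent EA (connEvent ends a₁ z)) := by
    rw [side_eq, side_eq, side_eq]
    have := prob_mul_prob_le_prob_inter (CDCutVertex.isProbVec_zeroOff hp EA)
      (isUpperSet_connEvent ends a₁ b) (isUpperSet_connEvent ends a₁ z)
    linarith
  have hα0 := prob_nonneg hp (CutV.sideEvent EA (connEvent ends a₁ z))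
  have hα1 := prob_le_one hp (CutV.sideEvent EA (connEvent ends a₁ z))
  have hT := sideT_nonneg p ends EB hp a₂ o v z
  have hTW := sideT_sub_sideW_nonneg p ends EB hp a₂ o v z
  have hin : sideT p ends EB a₂ o v z -
      prob p (CutV.sideEvent EA (connEvent ends a₁ z)) * sideW p ends EB a₂ o v z =
      (1 - prob p (CutV.sideEvent EA (connEvent ends a₁ z))) * sideT p ends EB a₂ o v z +
        prob p (CutV.sideEvent EA (connEvent ends a₁ z)) *
          (sideT p ends EB a₂ o v z - sideW p ends EB a₂ o v z) := by ring
  rw [hin]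
  exact mul_nonneg hκ (add_nonneg (mul_nonneg (by linarith) hT) (mul_nonneg hα0 hTW))

end GroupL

/-! ## The mirror half: `groupH = P(Q, bH) · α · Hb(α)` -/

section HalfH

variable (p : E → R) (ends : E → Sym2 V) (EB : Set E) [DecidablePred (· ∈ EB)]

/-- **The `B`-side mirror bracket `Hb(u)`** (affine in `u`), in side masses:
`(1 − u·γ)·[P(o↔z, v↮z, a₂↮z) − P(a₂↔o, v↔z, a₂↮z)] + [u·P(o↔z, a₂↮z) + P(a₂↔o) − u·P(a₂↔o, a₂↔z)]·P(v↔z, a₂↮z)`. -/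
noncomputable def sideHb (u : R) (a₂ o v z : V) : R :=
  (1 - u * prob p (CutV.sideEvent EB (connEvent ends a₂ z))) *
      ((prob p (CutV.sideEvent EB (connEvent ends o z)) -
          prob p (CutV.sideEvent EB (connEvent ends o z ∩ connEvent ends a₂ z))) -
        (prob p (CutV.sideEvent EB (connEvent ends v z ∩ connEvent ends o z)) -
          prob p (CutV.sideEvent EB (connEvent ends v z ∩ connEvent ends o z ∩
            connEvent ends a₂ z))) -
        (prob p (CutV.sideEvent EB (connEvent ends v z ∩ connEvent ends a₂ o)) -
          prob p (CutV.sideEvent EB (connEvent ends v z ∩ connEvent ends a₂ o ∩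
            connEvent ends a₂ z)))) +
    (u * (prob p (CutV.sideEvent EB (connEvent ends o z)) -
          prob p (CutV.sideEvent EB (connEvent ends o z ∩ connEvent ends a₂ z))) +
        prob p (CutV.sideEvent EB (connEvent ends a₂ o)) -
        u * prob p (CutV.sideEvent EB (connEvent ends a₂ o ∩ connEvent ends a₂ z))) *
      (prob p (CutV.sideEvent EB (connEvent ends v z)) -
        prob p (CutV.sideEvent EB (connEvent ends v z ∩ connEvent ends a₂ z)))

variable {z : V} {VA VB : Set V} {EA : Set E} [DecidablePred (· ∈ EA)]

omit [Fintype V] [DecidableEq V] [LinearOrder R] [IsStrictOrderedRing R] in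
/-- **The mirror half factorises across the cut**:
`groupH = [P_A(b↔z) − P_A(b↔z, a₁↔z)]·P_B(a₂↔z)·P_A(a₁↔z)·Hb(P_A(a₁↔z))`. -/
theorem groupH_eq (h : CutV.IsCut ends z VA VB EA EB) {a₁ a₂ b o v : V} (ha₁ : a₁ ∈ VA)
    (hb : b ∈ VA) (ha₂ : a₂ ∈ VB) (ho : o ∈ VB) (hv : v ∈ VB) :
    groupH p ends o a₁ a₂ v b =
      (prob p (CutV.sideEvent EA (connEvent ends b z)) -
          prob p (CutV.sideEvent EA (connEvent ends b z ∩ connEvent ends a₁ z))) *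
        prob p (CutV.sideEvent EB (connEvent ends a₂ z)) *
        prob p (CutV.sideEvent EA (connEvent ends a₁ z)) *
        sideHb p ends EB (prob p (CutV.sideEvent EA (connEvent ends a₁ z))) a₂ o v z := by
  unfold groupH anticov threeC mU sideHb
  rw [mass_Q p ends h ha₁ ha₂, mass_bH p ends h ha₁ hb ha₂, mass_oL p ends h ha₁ ha₂ ho,
    mass_oL p ends h ha₁ ha₂ hv, mass_oH p ends h ha₁ ha₂ ho, mass_oLbH p ends h ha₁ hb ha₂ ho,
    mass_oLbH p ends h ha₁ hb ha₂ hv, mass_vLoLbH p ends h ha₁ hb ha₂ ho hv,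
    mass_vLoHbH p ends h ha₁ hb ha₂ ho hv, mass_vLoL p ends h ha₁ ha₂ ho hv,
    mass_vLoH p ends h ha₁ ha₂ ho hv]
  ring

end HalfH

/-! ## `0 ≤ groupH` on the class and the theorem -/

section GroupH

variable (p : E → R) (ends : E → Sym2 V) (EB : Set E) [DecidablePred (· ∈ EB)]

omit [Fintype V] [DecidableEq V] [LinearOrder R] [IsStrictOrderedRing R] in
/-- `Hb(u) = (1 − u)·hb0 + u·hb1` (`ClusterOutsideMark.hb0 / hb1` on the `B`-side). -/
lemma sideHb_eq (u : R) (a₂ o v z : V) :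
    sideHb p ends EB u a₂ o v z =
      (1 - u) * ClusterOutsideMark.hb0 (fun e => if e ∈ EB then p e else 0) ends a₂ o v z +
        u * ClusterOutsideMark.hb1 (fun e => if e ∈ EB then p e else 0) ends a₂ o v z := by
  unfold sideHb ClusterOutsideMark.hb0 ClusterOutsideMark.hb1
  simp only [← side_eq]
  have e1 : connEvent ends a₂ o ∩ (connEvent ends v z ∩ (connEvent ends a₂ z)ᶜ) =
      connEvent ends v z ∩ connEvent ends a₂ o ∩ (connEvent ends a₂ z)ᶜ := by
    ext ω; simp only [Set.mem_inter_iff, Set.mem_compl_iff]; tauto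
  have e2 : connEvent ends o z ∩ (connEvent ends v z)ᶜ ∩ (connEvent ends a₂ z)ᶜ =
      connEvent ends o z ∩ (connEvent ends a₂ z)ᶜ ∩ (connEvent ends v z)ᶜ := by
    ext ω; simp only [Set.mem_inter_iff, Set.mem_compl_iff]; tauto
  rw [e1, e2, side_compl p EB (connEvent ends v z ∩ connEvent ends a₂ o) (connEvent ends a₂ z),
    side_compl p EB (connEvent ends o z ∩ (connEvent ends a₂ z)ᶜ) (connEvent ends v z),
    side_compl p EB (connEvent ends o z) (connEvent ends a₂ z),
    side_compl p EB (connEvent ends v z) (connEvent ends a₂ z),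
    side_compl p EB (connEvent ends a₂ o) (connEvent ends a₂ z)]
  have e3 : connEvent ends o z ∩ (connEvent ends a₂ z)ᶜ ∩ connEvent ends v z =
      connEvent ends v z ∩ connEvent ends o z ∩ (connEvent ends a₂ z)ᶜ := by
    ext ω; simp only [Set.mem_inter_iff, Set.mem_compl_iff]; tauto
  rw [e3, side_compl p EB (connEvent ends v z ∩ connEvent ends o z) (connEvent ends a₂ z)]
  ring

variable {z : V} {VA VB : Set V} {EA : Set E} [DecidablePred (· ∈ EA)]

/-- **The mirror half of (G2) holds across the cut**: `0 ≤ groupH`. -/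
theorem groupH_nonneg (hp : IsProbVec p) (h : CutV.IsCut ends z VA VB EA EB) {a₁ a₂ b o v : V}
    (ha₁ : a₁ ∈ VA) (hb : b ∈ VA) (ha₂ : a₂ ∈ VB) (ho : o ∈ VB) (hv : v ∈ VB) :
    0 ≤ groupH p ends o a₁ a₂ v b := by
  rw [groupH_eq p ends EB h ha₁ hb ha₂ ho hv, sideHb_eq]
  have hσ : 0 ≤ prob p (CutV.sideEvent EA (connEvent ends b z)) -
      prob p (CutV.sideEvent EA (connEvent ends b z ∩ connEvent ends a₁ z)) := by
    have := side_mono p EA hp (X := connEvent ends b z ∩ connEvent ends a₁ z)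
      (Y := connEvent ends b z) Set.inter_subset_left
    linarith
  have hγ := prob_nonneg hp (CutV.sideEvent EB (connEvent ends a₂ z))
  have hα0 := prob_nonneg hp (CutV.sideEvent EA (connEvent ends a₁ z))
  have hα1 := prob_le_one hp (CutV.sideEvent EA (connEvent ends a₁ z))
  have hHb := ClusterOutsideMark.hb_interp_nonneg (fun e => if e ∈ EB then p e else 0) ends
    (CDCutVertex.isProbVec_zeroOff hp EB) a₂ o v z hα0 hα1
  exact mul_nonneg (mul_nonneg (mul_nonneg hσ hγ) hα0) hHb

/-- **THE CUT-VERTEX CLASS THEOREM for row (LEAF-½)**: if a cut vertex `z` separates `{a₁, b}`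
(on the `A`-side) from `{a₂, o, v}` (on the `B`-side), then `LeafRow p ends o a₁ a₂ v b` — the
(G2) grouping is nonnegative on both halves (`groupL_nonneg`, `groupH_nonneg`) and
`LeafHalfCrossRed.LeafRow_of_G2` assembles the row. -/
theorem LeafRow_of_cut (hp : IsProbVec p) (h : CutV.IsCut ends z VA VB EA EB) {a₁ a₂ b o v : V}
    (ha₁ : a₁ ∈ VA) (hb : b ∈ VA) (ha₂ : a₂ ∈ VB) (ho : o ∈ VB) (hv : v ∈ VB) :
    LeafRow p ends o a₁ a₂ v b :=
  LeafRow_of_G2 p ends hp o a₁ a₂ v b (groupL_nonneg p ends hp h ha₁ hb ha₂ ho hv)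
    (groupH_nonneg p ends EB hp h ha₁ hb ha₂ ho hv)

end GroupH

/-! ## The root mirror -/

section Mirror

variable (p : E → R) (ends : E → Sym2 V)

omit [Fintype V] in
/-- `R½` is symmetric in the roots (`halfL` and `halfH` exchange under the swap). -/
lemma Rhalf_root_swap (o a₁ a₂ v b : V) :
    Rhalf p ends o a₂ a₁ v b = Rhalf p ends o a₁ a₂ v b := by
  rw [Rhalf_eq_halfL_add_halfH, Rhalf_eq_halfL_add_halfH]
  unfold halfL halfH anticov mU threeC
  simp only [avoidAll_root_swap ends a₁ a₂]
  ring

omit [Fintype V] in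
/-- Row (LEAF-½) is symmetric in the roots. -/
lemma LeafRow_root_swap (o a₁ a₂ v b : V) :
    LeafRow p ends o a₂ a₁ v b ↔ LeafRow p ends o a₁ a₂ v b := by
  unfold LeafRow
  rw [Rhalf_root_swap]

variable {z : V} {VA VB : Set V} {EA EB : Set E} [DecidablePred (· ∈ EA)] [DecidablePred (· ∈ EB)]

/-- **The mirror class**: a cut vertex `z` separating `{a₂, b}` (the `A`-side) from `{a₁, o, v}`
(the `B`-side) also gives row (LEAF-½). -/
theorem LeafRow_of_cut' (hp : IsProbVec p) (h : CutV.IsCut ends z VA VB EA EB) {a₁ a₂ b o v : V}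
    (ha₂ : a₂ ∈ VA) (hb : b ∈ VA) (ha₁ : a₁ ∈ VB) (ho : o ∈ VB) (hv : v ∈ VB) :
    LeafRow p ends o a₁ a₂ v b :=
  (LeafRow_root_swap p ends o a₁ a₂ v b).1 (LeafRow_of_cut p ends EB hp h ha₂ hb ha₁ ho hv)

end Mirror

end CutLeafRow

end Summit.Ventures.PercRepro2
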